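import Summits.Ventures.PercRepro.MSTightProj

/-!
# The excess of a family dominates the excess of its trace plus the excess of its partner family

Dossier proofs/MINE1-theoremS.md, Addendum 48 supplement 1. For a family `F` and an element `r`
write `P = proj r F` (the trace), `K = partner r F` (the sets appearing both with and without `r`)
and `exc(G) = |G \\ G| − |G|` (the Marica–Schönheim excess). The projection identity
`|F \\ F| = |P \\ P| + |X ∩ Y|` with `K \\ K ⊆ X ∩ Y` and `|F| = |P| + |K|` gives at once
**`exc(K) + exc(P) ≤ exc(F)`** (`card_diffs_partner_add_card_diffs_proj_le`): the excess of a
family is at least the excess of its trace plus the excess of its partner family, at every `r`.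
Consequences: for a family of excess one, `exc(P) + exc(K) ≤ 1` — at a tightening direction
(`P` tight) the partner family has excess ≤ 1 (the cases (α)/(β) of Addendum 44), and at a
non-tightening direction the partner family is tight (the first half of Theorem (NT),
Addendum 10); for a tight family both `P` and `K` are tight (p4's `tight_proj_and_partner`).
-/

namespace PercRepro.MSTight

open Finset
open scoped FinsetFamily

variable {α : Type*} [DecidableEq α]

/-- **`exc(K) + exc(P) ≤ exc(F)`**, in additive form:
`|K \\ K| + |P \\ P| + |F| ≤ |F \\ F| + |K| + |P|`. -/
theorem card_diffs_partner_add_card_diffs_proj_le (r : α) (F : Finset (Finset α)) :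
    (partner r F \\ partner r F).card + (proj r F \\ proj r F).card + F.card ≤
      (F \\ F).card + (partner r F).card + (proj r F).card := by
  have h1 := card_diffs_eq_card_diffs_proj_add r F
  have h2 := card_eq_card_proj_add_card_partner r F
  have h3 := card_le_card (diffs_partner_subset r F)
  omega

/-- For a family of excess one, `exc(P) + exc(K) ≤ 1`: in additive form
`|P \\ P| + |K \\ K| ≤ |P| + |K| + 1`. -/
theorem card_diffs_proj_add_card_diffs_partner_le_of_excess_one {r : α} {F : Finset (Finset α)}
    (hex : (F \\ F).card = F.card + 1) :
    (proj r F \\ proj r F).card + (partner r F \\ partner r F).card ≤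
      (proj r F).card + (partner r F).card + 1 := by
  have h := card_diffs_partner_add_card_diffs_proj_le r F
  omega

/-- At a tightening direction of an excess-one family the partner family has excess at most one. -/
theorem card_diffs_partner_le_of_excess_one_of_tight_proj {r : α} {F : Finset (Finset α)}
    (hex : (F \\ F).card = F.card + 1) (hP : Tight (proj r F)) :
    (partner r F \\ partner r F).card ≤ (partner r F).card + 1 := by
  have h := card_diffs_proj_add_card_diffs_partner_le_of_excess_one (r := r) hex
  unfold Tight at hP
  omega

/-- At a non-tightening direction of an excess-one family the partner family is tight
(the first half of Theorem (NT)). -/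
theorem tight_partner_of_excess_one_of_not_tight_proj {r : α} {F : Finset (Finset α)}
    (hex : (F \\ F).card = F.card + 1) (hP : ¬ Tight (proj r F)) : Tight (partner r F) := by
  have h := card_diffs_proj_add_card_diffs_partner_le_of_excess_one (r := r) hex
  have hP' := card_le_card_diffs (proj r F)
  have hK := card_le_card_diffs (partner r F)
  unfold Tight at hP ⊢
  omega

end PercRepro.MSTight
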